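import Literature.Probability.LatticeModels.HalfPlaneStates
import HarnessLib

/-!
# The increasing limit `μ⁺_- = lim_n μ⁺_{n,-}` of the semi-infinite states (Georgii–Higuchi 2000, §4)

Topic `Probability/LatticeModels`. Georgii–Higuchi, J. Math. Phys. 41 (2000), proof of Lemma 4.2:
"For `n ≥ 0` let `π_{n,up} = π_up + (0, -n)` and `μ⁺_{n,-} = μ^±_up ∘ ϑ^{-n}_{vert}` ... by
stochastic monotonicity ... `μ⁺_{n,-} ≺ μ⁺_{n+1,-}`, so that the stochastically increasing limit
`μ⁺_- = lim_{n→∞} μ⁺_{n,-}` exists. Clearly `μ⁺_- ∈ 𝒢`, and `μ⁺_-` inherits the horizontal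
invariance of the `μ⁺_{n,-}`. In general, we cannot expect that `μ⁺_-` is also vertically invariant"
— but along the construction of `HalfPlaneStates` (our `μ⁺_{n,-}` is `upperPMState hβ (-n)`, the
state with the wall at height `-n`, obtained from the SAME exhausting volumes translated) it is:
shifting by `(0, 1)` maps `μ⁺_{n+1,-}` exactly to `μ⁺_{n,-}`, so the limit is invariant under the
vertical unit shift as well. Contents:

* `wallLimitState hβ` — the increasing limit (via `exists_limit_of_monotone`), local convergence,
  domination of each `μ⁺_{n,-}` on increasing local observables;
* `isGibbsMeasure_wallLimitState` — `μ⁺_- ∈ 𝒢(β, 0)` (DLR in `π_{-n}` for each `n`, passing to the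
  limit);
* `wallLimitState_map_shift_horiz_one`, `wallLimitState_map_shift_vert_one`,
  `isTranslationInvariantMeasure_wallLimitState` — `μ⁺_-` is invariant under all translations;
* `integral_spinAt_zero_upperPMState_neg` — `μ⁺_{n,-}(σ_0) = μ^±_0(σ_{(0,n)})`.

## References

* H.-O. Georgii, Y. Higuchi, J. Math. Phys. 41 (2000), §4, proof of Lemma 4.2 (p. 10)
  [GeorgiiHiguchi2000].
-/

noncomputable section

open MeasureTheory Filter Topology Finset
open Literature.Probability.Percolation

namespace Literature.Probability.LatticeModels

variable {β : ℝ}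

/-- **`μ⁺_{n,-}` increases with `n`** on increasing local observables. [cite: GeorgiiHiguchi2000, Lemma 4.2 (proof)] -/
theorem monotone_integral_upperPMState_neg (hβ : 0 ≤ β) {D : Finset (Site 2)}
    {f : SpinConfig (Site 2) → ℝ} (hfD : DependsOn f (↑D : Set (Site 2))) (hf : Monotone f)
    (hfm : Measurable f) (hfb : ∀ σ, |f σ| ≤ 1) :
    Monotone fun n : ℕ => ∫ σ, f σ ∂(upperPMState hβ (-(n : ℤ))) :=
  monotone_nat_of_le_succ fun n =>
    integral_upperPMState_mono_level hβ (by push_cast; linarith) hfD hf hfm hfb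

/-- Existence of the increasing limit with its defining properties. [cite: GeorgiiHiguchi2000, Lemma 4.2 (proof)] -/
theorem exists_wallLimitState (hβ : 0 ≤ β) :
    ∃ μ : Measure (SpinConfig (Site 2)), IsProbabilityMeasure μ ∧
      (∀ (D : Finset (Site 2)) (F : SpinConfig (Site 2) → ℝ), DependsOn F (↑D : Set (Site 2)) →
        Tendsto (fun n : ℕ => ∫ σ, F σ ∂(upperPMState hβ (-(n : ℤ)))) atTop (𝓝 (∫ σ, F σ ∂μ))) ∧
      ∀ (D : Finset (Site 2)) (f : SpinConfig (Site 2) → ℝ), DependsOn f (↑D : Set (Site 2)) →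
        Monotone f → Measurable f → (∀ σ, |f σ| ≤ 1) →
          ∀ n : ℕ, ∫ σ, f σ ∂(upperPMState hβ (-(n : ℤ))) ≤ ∫ σ, f σ ∂μ :=
  exists_limit_of_monotone (fun n : ℕ => upperPMState hβ (-(n : ℤ)))
    fun _ _ hfD hf hfm hfb => monotone_integral_upperPMState_neg hβ hfD hf hfm hfb

/-- **The state `μ⁺_- = lim_n μ⁺_{n,-}`** (Georgii–Higuchi 2000, proof of Lemma 4.2). [cite: GeorgiiHiguchi2000, Lemma 4.2 (proof)] -/
def wallLimitState (hβ : 0 ≤ β) : Measure (SpinConfig (Site 2)) :=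
  (exists_wallLimitState hβ).choose

/-- `μ⁺_-` is a probability measure. [folklore] -/
instance (hβ : 0 ≤ β) : IsProbabilityMeasure (wallLimitState hβ) :=
  (exists_wallLimitState hβ).choose_spec.1

/-- Local expectations of `μ⁺_{n,-}` converge to those of `μ⁺_-`. [cite: GeorgiiHiguchi2000, Lemma 4.2 (proof)] -/
theorem tendsto_integral_wallLimitState (hβ : 0 ≤ β) {D : Finset (Site 2)}
    {F : SpinConfig (Site 2) → ℝ} (hF : DependsOn F (↑D : Set (Site 2))) :
    Tendsto (fun n : ℕ => ∫ σ, F σ ∂(upperPMState hβ (-(n : ℤ)))) atTop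
      (𝓝 (∫ σ, F σ ∂(wallLimitState hβ))) :=
  (exists_wallLimitState hβ).choose_spec.2.1 D F hF

/-- `μ⁺_{n,-} ≼ μ⁺_-` on increasing local observables. [cite: GeorgiiHiguchi2000, Lemma 4.2 (proof)] -/
theorem integral_upperPMState_le_wallLimitState (hβ : 0 ≤ β) {D : Finset (Site 2)}
    {f : SpinConfig (Site 2) → ℝ} (hfD : DependsOn f (↑D : Set (Site 2))) (hf : Monotone f)
    (hfm : Measurable f) (hfb : ∀ σ, |f σ| ≤ 1) (n : ℕ) :
    ∫ σ, f σ ∂(upperPMState hβ (-(n : ℤ))) ≤ ∫ σ, f σ ∂(wallLimitState hβ) :=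
  (exists_wallLimitState hβ).choose_spec.2.2 D f hfD hf hfm hfb n

/-- **`μ⁺_- ∈ 𝒢(β, 0)`** ("Clearly `μ⁺_- ∈ 𝒢`"): the DLR equations in `π_{-n}` hold for `μ⁺_{n,-}`
and the half-planes `π_{-n}` exhaust `ℤ²`. [cite: GeorgiiHiguchi2000, Lemma 4.2 (proof)] -/
theorem isGibbsMeasure_wallLimitState (hβ : 0 ≤ β) :
    IsGibbsMeasure (isingSpecification (zdGraph 2) β 0) (wallLimitState hβ) := by
  have hW : Monotone fun n : ℕ => halfPlane (-(n : ℤ)) := by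
    intro n n' hnn' x hx
    simp only [halfPlane, Set.mem_setOf_eq] at hx ⊢
    have : (n : ℤ) ≤ n' := by exact_mod_cast hnn'
    linarith
  have h := isGibbsIn_iUnion_of_tendsto (fun n : ℕ => halfPlane (-(n : ℤ))) hW
    (fun n : ℕ => upperPMState hβ (-(n : ℤ))) (fun n => isGibbsIn_upperPMState hβ _)
    (wallLimitState hβ) (fun D F hF => tendsto_integral_wallLimitState hβ hF)
  have huniv : (Set.univ : Set (Site 2)) ⊆ ⋃ n : ℕ, halfPlane (-(n : ℤ)) := by
    intro x _
    refine Set.mem_iUnion.2 ⟨(x 1).natAbs, ?_⟩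
    simp only [halfPlane, Set.mem_setOf_eq, Int.natCast_natAbs]
    linarith [neg_abs_le (x 1)]
  exact isGibbsIn_univ_iff.1 (h.mono huniv)

/-- `μ⁺_- ∈ 𝒢(β, 0)`, membership form. [cite: GeorgiiHiguchi2000, Lemma 4.2 (proof)] -/
theorem wallLimitState_mem_isingGibbsMeasures (hβ : 0 ≤ β) : wallLimitState hβ ∈ isingGibbsMeasures 2 β 0 :=
  isGibbsMeasure_wallLimitState hβ

/-- **`μ⁺_-` is horizontally invariant** ("inherits the horizontal invariance of the `μ⁺_{n,-}`"). [cite: GeorgiiHiguchi2000, Lemma 4.2 (proof)] -/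
theorem wallLimitState_map_shift_horiz_one (hβ : 0 ≤ β) :
    (wallLimitState hβ).map (configRelabel (Site.shift (horiz 1))) = wallLimitState hβ := by
  classical
  haveI : IsProbabilityMeasure ((wallLimitState hβ).map (configRelabel (Site.shift (horiz 1)))) :=
    Measure.isProbabilityMeasure_map (configRelabel _).measurable.aemeasurable
  refine measure_eq_of_forall_integral_plusIndicator_eq _ _ fun S => ?_
  rw [integral_map_equiv]
  have h1 := tendsto_integral_wallLimitState hβ
    (DependsOn.comp_configRelabel_shift (dependsOn_plusIndicator' S) (horiz 1))
  have h2 : ∀ n : ℕ, ∫ σ, (plusIndicator S ∘ configRelabel (Site.shift (horiz 1))) σ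
      ∂(upperPMState hβ (-(n : ℤ))) = ∫ σ, plusIndicator S σ ∂(upperPMState hβ (-(n : ℤ))) := by
    intro n
    conv_rhs => rw [← upperPMState_map_shift_horiz_one hβ (-(n : ℤ))]
    rw [integral_map_equiv]; rfl
  simp_rw [h2] at h1
  exact tendsto_nhds_unique h1 (tendsto_integral_wallLimitState hβ (dependsOn_plusIndicator' S))

/-- **`μ⁺_-` is invariant under the vertical unit shift**: `ϑ_{(0,1)}` maps `μ⁺_{n+1,-}` to
`μ⁺_{n,-}`, a cofinal subsequence of the same increasing sequence. [cite: GeorgiiHiguchi2000, Lemma 4.2 (proof)] -/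
theorem wallLimitState_map_shift_vert_one (hβ : 0 ≤ β) :
    (wallLimitState hβ).map (configRelabel (Site.shift (vert 1))) = wallLimitState hβ := by
  classical
  haveI : IsProbabilityMeasure ((wallLimitState hβ).map (configRelabel (Site.shift (vert 1)))) :=
    Measure.isProbabilityMeasure_map (configRelabel _).measurable.aemeasurable
  refine measure_eq_of_forall_integral_plusIndicator_eq _ _ fun S => ?_
  rw [integral_map_equiv]
  have h1 := tendsto_integral_wallLimitState hβ
    (DependsOn.comp_configRelabel_shift (dependsOn_plusIndicator' S) (vert 1))
  -- along `n + 1`: `∫ n_S ∘ T dμ⁺_{n+1,-} = ∫ n_S dμ⁺_{n,-}`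
  have h1' := (tendsto_add_atTop_iff_nat 1).2 h1
  have h2 : ∀ n : ℕ, ∫ σ, (plusIndicator S ∘ configRelabel (Site.shift (vert 1))) σ
      ∂(upperPMState hβ (-((n + 1 : ℕ) : ℤ))) = ∫ σ, plusIndicator S σ ∂(upperPMState hβ (-(n : ℤ))) := by
    intro n
    have h3 : upperPMState hβ (-(n : ℤ)) =
        (upperPMState hβ (-((n + 1 : ℕ) : ℤ))).map (configRelabel (Site.shift (vert 1))) := by
      rw [upperPMState_map_shift_vert]
      congr 1; push_cast; ring
    rw [h3, integral_map_equiv]; rfl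
  have h1'' : Tendsto (fun n : ℕ => ∫ σ, plusIndicator S σ ∂(upperPMState hβ (-(n : ℤ)))) atTop
      (𝓝 (∫ σ, (plusIndicator S ∘ configRelabel (Site.shift (vert 1))) σ ∂(wallLimitState hβ))) :=
    h1'.congr fun n => h2 n
  exact tendsto_nhds_unique h1'' (tendsto_integral_wallLimitState hβ (dependsOn_plusIndicator' S))

/-- Invariance under the shifts by a family of generators of `ℤ^d` gives invariance under all
translations (the invariance vectors form a subgroup). [folklore] -/
theorem map_configRelabel_shift_eq_of_generators {d : ℕ} {μ : Measure (SpinConfig (Site d))}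
    (hgen : ∀ i : Fin d, μ.map (configRelabel (Site.shift (Pi.single i 1 : Site d))) = μ) :
    ∀ v : Site d, μ.map (configRelabel (Site.shift v)) = μ := by
  have hmeas : ∀ u : Site d, Measurable (configRelabel (Site.shift u)) := fun u =>
    (configRelabel (Site.shift u)).measurable
  let Sg : AddSubgroup (Site d) :=
    { carrier := {u | μ.map (configRelabel (Site.shift u)) = μ}
      add_mem' := fun {a b} ha hb => by
        simp only [Set.mem_setOf_eq] at ha hb ⊢
        rw [configRelabel_shift_add, ← Measure.map_map (hmeas a) (hmeas b), hb, ha]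
      zero_mem' := by
        simp only [Set.mem_setOf_eq]
        rw [configRelabel_shift_zero, Measure.map_id]
      neg_mem' := fun {a} ha => by
        simp only [Set.mem_setOf_eq] at ha ⊢
        conv_lhs => rw [← ha]
        rw [Measure.map_map (hmeas (-a)) (hmeas a), ← configRelabel_shift_add, neg_add_cancel,
          configRelabel_shift_zero, Measure.map_id] }
  intro v
  have hv : v = ∑ i, v i • (Pi.single i 1 : Site d) := by
    conv_lhs => rw [← Finset.univ_sum_single v]
    refine Finset.sum_congr rfl fun i _ => ?_
    ext j
    simp only [Pi.smul_apply, Pi.single_apply, smul_eq_mul]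
    split_ifs <;> ring
  rw [hv]
  exact Sg.sum_mem fun i _ => Sg.zsmul_mem (hgen i) (v i)

/-- **`μ⁺_-` is translation invariant.** [cite: GeorgiiHiguchi2000, Lemma 4.2 (proof)] -/
theorem isTranslationInvariantMeasure_wallLimitState (hβ : 0 ≤ β) :
    IsTranslationInvariantMeasure (wallLimitState hβ) := by
  intro v
  change (wallLimitState hβ).map (configRelabel (Site.shift v)) = wallLimitState hβ
  refine map_configRelabel_shift_eq_of_generators (fun i => ?_) v
  fin_cases i
  · have : (Pi.single (0 : Fin 2) 1 : Site 2) = horiz 1 := by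
      ext j; fin_cases j <;> rfl
    change (wallLimitState hβ).map (configRelabel (Site.shift (Pi.single (0 : Fin 2) 1))) = _
    rw [this]
    exact wallLimitState_map_shift_horiz_one hβ
  · have : (Pi.single (1 : Fin 2) 1 : Site 2) = vert 1 := by
      ext j; fin_cases j <;> rfl
    change (wallLimitState hβ).map (configRelabel (Site.shift (Pi.single (1 : Fin 2) 1))) = _
    rw [this]
    exact wallLimitState_map_shift_vert_one hβ

/-- **The magnetisation at the origin under `μ⁺_{n,-}` is the magnetisation at height `n` under
`μ^±_0`.** [cite: GeorgiiHiguchi2000, Lemma 4.2 (proof)] -/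
theorem integral_spinAt_zero_upperPMState_neg (hβ : 0 ≤ β) (n : ℕ) :
    ∫ σ, spinAt 0 σ ∂(upperPMState hβ (-(n : ℤ))) = ∫ σ, spinAt (vert n) σ ∂(upperPMState hβ 0) := by
  have h : upperPMState hβ (-(n : ℤ)) = (upperPMState hβ 0).map (configRelabel (Site.shift (vert (-(n : ℤ))))) := by
    rw [upperPMState_map_shift_vert, zero_add]
  rw [h, integral_map_equiv]
  have hv : (0 : Site 2) - vert (-(n : ℤ)) = vert n := by
    ext j; fin_cases j <;> simp [vert]
  refine integral_congr_ae (Eventually.of_forall fun σ => ?_)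
  simp only [spinAt, configRelabel_shift_apply, hv]

end Literature.Probability.LatticeModels
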